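import Mathlib.Analysis.SpecialFunctions.ArithmeticGeometricMean
import Mathlib.Analysis.Normed.Group.Tannery
import Mathlib.Analysis.Normed.Ring.InfiniteSum
import Mathlib.Analysis.SpecificLimits.Normed
import Mathlib.Topology.Algebra.InfiniteSum.NatInt
import Literature.Analysis.SpecialFunctions.ThetaRiemannSum
import HarnessLib

/-!
# Jacobi's theta functions `θ₃, θ₄` of a real nome and the AGM: `M(θ₃(q)², θ₄(q)²) = 1`

For a real nome `|q| < 1` let `θ₃(q) = ∑_{n ∈ ℤ} q^{n²}` (`thetaThree`) and
`θ₄(q) = ∑_{n ∈ ℤ} (−1)ⁿ q^{n²} = θ₃(−q)` (`thetaFour`; `(−1)^{n²} = (−1)ⁿ`). Proved here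
(Borwein–Borwein, *Pi and the AGM*, §2.1, eqs. (2.1.7)–(2.1.8) and Thm 2.1's AGM step):

* `thetaThree_sq_add_thetaFour_sq` : `θ₃(q)² + θ₄(q)² = 2·θ₃(q²)²`;
* `thetaThree_mul_thetaFour`       : `θ₃(q)·θ₄(q)  = θ₄(q²)²`
  (both by writing the products as absolutely convergent double sums over `ℤ²`, in which only the
  sublattice `m ≡ n (mod 2)` contributes, re-indexed by `(m,n) = (u+v, u−v)`,
  `m² + n² = 2(u² + v²)`);
* `tendsto_thetaThree_nhds_zero` : `θ₃(q) → 1` as `q → 0` (Tannery), hence along `q^{2ⁿ}`;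
* `thetaFour_pos`, `one_le_thetaThree` (`0 ≤ q < 1`);
* `agm_thetaFourSq_thetaThreeSq` : **`M(θ₄(q)², θ₃(q)²) = 1`** for `0 ≤ q < 1`: by the two
  identities one AGM step sends `(θ₄(q)², θ₃(q)²)` to `(θ₄(q²)², θ₃(q²)²)`, so the AGM is that of
  `(θ₄(q^{2ⁿ})², θ₃(q^{2ⁿ})²) → (1, 1)`, squeezed between `min` and `max` (Mathlib's
  `NNReal.min_le_agm`, `NNReal.agm_le_max`).

With Gauss's theorem `K(k) = π/(2·M(1,k′))` (`EllipticKAGM.lean`) this gives Jacobi's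
parametrisation `K(k) = (π/2)·θ₃(q)²` at the modulus `k′ = θ₄(q)²/θ₃(q)²` — the next brick of the
road to the singular values `K(k_N)` (`[borwein-piagm]`) behind
`Literature.Analysis.FunctionSpaces.BorweinStraubWanZudilin2012_eq_5_3`; it is stated in a sibling
file once both inputs are in the tree. Bridge to the tree's Gaussian lattice sum
(`ThetaRiemannSum.lean`): `gaussLatticeSum c = θ₃(e^{−c})` (`gaussLatticeSum_eq_thetaThree`).
Not here: `θ₂`, Jacobi's quartic identity `θ₃⁴ = θ₂⁴ + θ₄⁴`, the nome–modulus inversion.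

## References

* [BorweinBorwein1987] J. M. Borwein, P. B. Borwein, *Pi and the AGM*, Wiley (1987), §2.1:
  (2.1.1) (definitions), (2.1.7)–(2.1.8) (the two doubling identities), Thm 2.1 (AGM of
  `θ₃², θ₄²`).
* E. T. Whittaker, G. N. Watson, *A Course of Modern Analysis*, 4th ed., §21.3, §22.8.
-/

noncomputable section

open _root_.Filter _root_.Set Function
open scoped _root_.Topology NNReal

namespace Literature.Analysis.SpecialFunctions

/-! ### Definitions and summability -/

/-- **Jacobi's `θ₃` of a real nome**: `θ₃(q) = ∑_{n ∈ ℤ} q^{n²}` (`|q| < 1`).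
[cite: BorweinBorwein1987, §2.1 (2.1.1)] -/
def thetaThree (q : ℝ) : ℝ := ∑' n : ℤ, q ^ (n.natAbs ^ 2)

/-- **Jacobi's `θ₄` of a real nome**: `θ₄(q) = ∑_{n ∈ ℤ} (−1)ⁿ q^{n²} = θ₃(−q)`
(`(−1)^{n²} = (−1)ⁿ`). [cite: BorweinBorwein1987, §2.1 (2.1.1)] -/
def thetaFour (q : ℝ) : ℝ := thetaThree (-q)

/-- `∑_{n ∈ ℤ} |q|^{|n|}` converges for `|q| < 1`. [folklore] -/
theorem summable_abs_pow_natAbs {q : ℝ} (hq : |q| < 1) : Summable fun n : ℤ => |q| ^ n.natAbs := by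
  refine summable_int_iff_summable_nat_and_neg.2 ⟨?_, ?_⟩
  · simpa using summable_geometric_of_lt_one (abs_nonneg q) hq
  · simpa using summable_geometric_of_lt_one (abs_nonneg q) hq

/-- The theta series converges absolutely for `|q| < 1`. [folklore] -/
theorem summable_norm_thetaTerm {q : ℝ} (hq : |q| < 1) :
    Summable fun n : ℤ => ‖q ^ (n.natAbs ^ 2)‖ := by
  refine (summable_abs_pow_natAbs hq).of_nonneg_of_le (fun n => norm_nonneg _) fun n => ?_
  rw [norm_pow, Real.norm_eq_abs]
  exact pow_le_pow_of_le_one (abs_nonneg q) hq.le (Nat.le_self_pow two_ne_zero _)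

/-- The theta series converges for `|q| < 1`. [folklore] -/
theorem summable_thetaTerm {q : ℝ} (hq : |q| < 1) : Summable fun n : ℤ => q ^ (n.natAbs ^ 2) :=
  (summable_norm_thetaTerm hq).of_norm

/-- Bridge to `ThetaRiemannSum.lean`: `∑_{n ∈ ℤ} e^{−c n²} = θ₃(e^{−c})`. [folklore] -/
theorem gaussLatticeSum_eq_thetaThree (c : ℝ) : gaussLatticeSum c = thetaThree (Real.exp (-c)) := by
  unfold gaussLatticeSum thetaThree
  congr 1
  funext n
  have hn : ((n.natAbs ^ 2 : ℕ) : ℝ) = (n : ℝ) ^ 2 := by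
    have h1 : ((n.natAbs : ℕ) : ℝ) = |(n : ℝ)| := by
      rw [Nat.cast_natAbs, Int.cast_abs]
    push_cast
    rw [h1, sq_abs]
  rw [← Real.exp_nat_mul, hn]
  congr 1
  ring

/-- `1 ≤ θ₃(q)` for `0 ≤ q < 1` (the `n = 0` term is `1`, the others are `≥ 0`). [folklore] -/
theorem one_le_thetaThree {q : ℝ} (hq0 : 0 ≤ q) (hq1 : q < 1) : 1 ≤ thetaThree q := by
  have hq : |q| < 1 := by rwa [abs_of_nonneg hq0]
  have h := (summable_thetaTerm hq).le_tsum 0 (fun j _ => pow_nonneg hq0 _)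
  unfold thetaThree
  simpa using h

/-- `0 < θ₃(q)` for `0 ≤ q < 1`. [folklore] -/
theorem thetaThree_pos {q : ℝ} (hq0 : 0 ≤ q) (hq1 : q < 1) : 0 < thetaThree q :=
  lt_of_lt_of_le one_pos (one_le_thetaThree hq0 hq1)

/-! ### Double sums over `ℤ²` and the even sublattice -/

/-- `θ₃(q) θ₃(r)` as an absolutely convergent double sum. [folklore] -/
theorem thetaThree_mul_thetaThree {q r : ℝ} (hq : |q| < 1) (hr : |r| < 1) :
    thetaThree q * thetaThree r =
      ∑' z : ℤ × ℤ, q ^ (z.1.natAbs ^ 2) * r ^ (z.2.natAbs ^ 2) :=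
  tsum_mul_tsum_of_summable_norm (f := fun n : ℤ => q ^ (n.natAbs ^ 2))
    (g := fun n : ℤ => r ^ (n.natAbs ^ 2)) (summable_norm_thetaTerm hq) (summable_norm_thetaTerm hr)

/-- Summability of the double family. [folklore] -/
theorem summable_thetaTerm_prod {q r : ℝ} (hq : |q| < 1) (hr : |r| < 1) :
    Summable fun z : ℤ × ℤ => q ^ (z.1.natAbs ^ 2) * r ^ (z.2.natAbs ^ 2) :=
  summable_mul_of_summable_norm (f := fun n : ℤ => q ^ (n.natAbs ^ 2))
    (g := fun n : ℤ => r ^ (n.natAbs ^ 2)) (summable_norm_thetaTerm hq) (summable_norm_thetaTerm hr)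

/-- **Re-indexing by the even sublattice**: if `F(m,n) = 0` whenever `m + n` is odd, then
`∑_{(m,n) ∈ ℤ²} F(m,n) = ∑_{(u,v) ∈ ℤ²} F(u+v, u−v)` (the map `(u,v) ↦ (u+v, u−v)` is a bijection of
`ℤ²` onto `{m ≡ n (mod 2)}`). [folklore] -/
theorem tsum_eq_tsum_even_lattice (F : ℤ × ℤ → ℝ) (hF : ∀ m n : ℤ, ¬ Even (m + n) → F (m, n) = 0) :
    ∑' z : ℤ × ℤ, F z = ∑' w : ℤ × ℤ, F (w.1 + w.2, w.1 - w.2) := by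
  symm
  apply Function.Injective.tsum_eq (g := fun w : ℤ × ℤ => (w.1 + w.2, w.1 - w.2)) (f := F)
  · rintro ⟨u, v⟩ ⟨u', v'⟩ h
    simp only [Prod.mk.injEq] at h
    obtain ⟨h1, h2⟩ := h
    have hu : u = u' := by linarith
    have hv : v = v' := by linarith
    rw [hu, hv]
  · rintro ⟨m, n⟩ hz
    have he : Even (m + n) := by
      by_contra h
      exact hz (hF m n h)
    obtain ⟨k, hk⟩ := he
    refine ⟨(k, k - n), ?_⟩
    simp only [Prod.mk.injEq]
    constructor <;> linarith

/-- Parity of `|m|² + |n|²` is that of `m + n`. [folklore] -/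
theorem even_natAbs_sq_add_iff (m n : ℤ) : Even (m.natAbs ^ 2 + n.natAbs ^ 2) ↔ Even (m + n) := by
  simp [Nat.even_add, Nat.even_pow, Int.natAbs_even, Int.even_add]

/-- Parity of `|m|²` is that of `m`. [folklore] -/
theorem even_natAbs_sq_iff (m : ℤ) : Even (m.natAbs ^ 2) ↔ Even m := by
  simp [Nat.even_pow, Int.natAbs_even]

/-- `|u+v|² + |u−v|² = 2(|u|² + |v|²)`. [folklore] -/
theorem natAbs_sq_add_add_natAbs_sq_sub (u v : ℤ) :
    (u + v).natAbs ^ 2 + (u - v).natAbs ^ 2 = 2 * (u.natAbs ^ 2 + v.natAbs ^ 2) := by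
  have h : (((u + v).natAbs ^ 2 + (u - v).natAbs ^ 2 : ℕ) : ℤ) =
      ((2 * (u.natAbs ^ 2 + v.natAbs ^ 2) : ℕ) : ℤ) := by
    push_cast [Int.natAbs_sq, sq_abs]
    ring
  exact_mod_cast h

/-- `(−1)^a = (−1)^b` when `a ≡ b (mod 2)`. [folklore] -/
theorem neg_one_pow_eq_of_even_iff {a b : ℕ} (h : Even a ↔ Even b) : (-1 : ℝ) ^ a = (-1) ^ b := by
  rcases Nat.even_or_odd a with ha | ha
  · rw [ha.neg_one_pow, (h.1 ha).neg_one_pow]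
  · have hb : Odd b := Nat.not_even_iff_odd.1 fun hb => (Nat.not_even_iff_odd.2 ha) (h.2 hb)
    rw [ha.neg_one_pow, hb.neg_one_pow]

/-! ### The two AGM identities -/

/-- **`θ₃(q)² + θ₄(q)² = 2 θ₃(q²)²`** (Borwein–Borwein (2.1.7) summed with its `q ↦ −q` twin;
`|q| < 1`). [cite: BorweinBorwein1987, §2.1 (2.1.7)] -/
theorem thetaThree_sq_add_thetaFour_sq {q : ℝ} (hq : |q| < 1) :
    thetaThree q ^ 2 + thetaFour q ^ 2 = 2 * thetaThree (q ^ 2) ^ 2 := by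
  have hq' : |-q| < 1 := by rwa [abs_neg]
  have hq2 : |q ^ 2| < 1 := by
    rw [abs_pow]; exact pow_lt_one₀ (abs_nonneg q) hq two_ne_zero
  unfold thetaFour
  rw [sq, sq (thetaThree (-q)), sq (thetaThree (q ^ 2)), thetaThree_mul_thetaThree hq hq,
    thetaThree_mul_thetaThree hq' hq', thetaThree_mul_thetaThree hq2 hq2,
    ← (summable_thetaTerm_prod hq hq).tsum_add (summable_thetaTerm_prod hq' hq'),
    tsum_eq_tsum_even_lattice _ ?_, ← tsum_mul_left]
  · congr 1
    funext w
    obtain ⟨u, v⟩ := w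
    simp only
    rw [← pow_add, ← pow_add, ← pow_add, natAbs_sq_add_add_natAbs_sq_sub, pow_mul, pow_mul,
      neg_sq]
    ring
  · intro m n hodd
    simp only
    have ho : Odd (m.natAbs ^ 2 + n.natAbs ^ 2) :=
      Nat.not_even_iff_odd.1 fun h => hodd ((even_natAbs_sq_add_iff m n).1 h)
    rw [← pow_add, ← pow_add, ho.neg_pow]
    ring

/-- **`θ₃(q) θ₄(q) = θ₄(q²)²`** (Borwein–Borwein (2.1.8); `|q| < 1`).
[cite: BorweinBorwein1987, §2.1 (2.1.8)] -/
theorem thetaThree_mul_thetaFour {q : ℝ} (hq : |q| < 1) :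
    thetaThree q * thetaFour q = thetaFour (q ^ 2) ^ 2 := by
  have hq' : |-q| < 1 := by rwa [abs_neg]
  have hq2 : |-q ^ 2| < 1 := by
    rw [abs_neg, abs_pow]; exact pow_lt_one₀ (abs_nonneg q) hq two_ne_zero
  unfold thetaFour
  set G : ℤ × ℤ → ℝ := fun z => q ^ (z.1.natAbs ^ 2) * (-q) ^ (z.2.natAbs ^ 2) with hG
  have hGs : Summable G := summable_thetaTerm_prod hq hq'
  have hGs' : Summable fun z : ℤ × ℤ => G z.swap :=
    (Equiv.prodComm ℤ ℤ).summable_iff.2 hGs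
  have h1 : thetaThree q * thetaThree (-q) = ∑' z, G z := thetaThree_mul_thetaThree hq hq'
  have h2 : thetaThree q * thetaThree (-q) = ∑' z : ℤ × ℤ, G z.swap := by
    rw [h1]; exact ((Equiv.prodComm ℤ ℤ).tsum_eq G).symm
  -- symmetrise: `2 θ₃θ₄ = ∑ (G z + G z.swap)`, which lives on the even sublattice
  have h3 : 2 * (thetaThree q * thetaThree (-q)) = ∑' z : ℤ × ℤ, (G z + G z.swap) := by
    rw [two_mul, hGs.tsum_add hGs', ← h1, ← h2]
  have h4 : ∑' z : ℤ × ℤ, (G z + G z.swap) =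
      ∑' w : ℤ × ℤ, 2 * ((-1 : ℝ) ^ (w.1.natAbs ^ 2 + w.2.natAbs ^ 2) *
        (q ^ 2) ^ (w.1.natAbs ^ 2 + w.2.natAbs ^ 2)) := by
    rw [tsum_eq_tsum_even_lattice _ ?_]
    · congr 1
      funext w
      obtain ⟨u, v⟩ := w
      simp only [hG, Prod.swap_prod_mk]
      have epar1 : (-1 : ℝ) ^ ((u - v).natAbs ^ 2) = (-1) ^ (u.natAbs ^ 2 + v.natAbs ^ 2) := by
        apply neg_one_pow_eq_of_even_iff
        rw [even_natAbs_sq_iff, even_natAbs_sq_add_iff, Int.even_sub, Int.even_add]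
      have epar2 : (-1 : ℝ) ^ ((u + v).natAbs ^ 2) = (-1) ^ (u.natAbs ^ 2 + v.natAbs ^ 2) := by
        apply neg_one_pow_eq_of_even_iff
        rw [even_natAbs_sq_iff, even_natAbs_sq_add_iff]
      rw [neg_pow q ((u - v).natAbs ^ 2), neg_pow q ((u + v).natAbs ^ 2), epar1, epar2]
      have e : q ^ ((u + v).natAbs ^ 2) * q ^ ((u - v).natAbs ^ 2) =
          (q ^ 2) ^ (u.natAbs ^ 2 + v.natAbs ^ 2) := by
        rw [← pow_add, natAbs_sq_add_add_natAbs_sq_sub, pow_mul]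
      rw [← e]
      ring
    · intro m n hodd
      simp only [hG, Prod.swap_prod_mk]
      rw [neg_pow q (n.natAbs ^ 2), neg_pow q (m.natAbs ^ 2)]
      -- parities of `|m|²` and `|n|²` differ
      have hmn : ¬ (Even (m.natAbs ^ 2) ↔ Even (n.natAbs ^ 2)) := by
        rw [even_natAbs_sq_iff, even_natAbs_sq_iff, ← Int.even_add]; exact hodd
      rcases Nat.even_or_odd (m.natAbs ^ 2) with hm | hm
      · have hn : Odd (n.natAbs ^ 2) := Nat.not_even_iff_odd.1 fun hn => hmn ⟨fun _ => hn, fun _ => hm⟩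
        rw [hm.neg_one_pow, hn.neg_one_pow]; ring
      · have hn : Even (n.natAbs ^ 2) := by
          by_contra hn
          exact hmn ⟨fun h => absurd h (Nat.not_even_iff_odd.2 hm), fun h => absurd h hn⟩
        rw [hm.neg_one_pow, hn.neg_one_pow]; ring
  -- the right-hand side: `θ₄(q²)² = ∑ (−1)^{|u|²+|v|²} (q²)^{|u|²+|v|²}`
  have h5 : thetaThree (-q ^ 2) * thetaThree (-q ^ 2) =
      ∑' w : ℤ × ℤ, (-1 : ℝ) ^ (w.1.natAbs ^ 2 + w.2.natAbs ^ 2) *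
        (q ^ 2) ^ (w.1.natAbs ^ 2 + w.2.natAbs ^ 2) := by
    rw [thetaThree_mul_thetaThree hq2 hq2]
    congr 1
    funext w
    rw [← pow_add, neg_pow]
  have h6 : 2 * (thetaThree q * thetaThree (-q)) = 2 * (thetaThree (-q ^ 2) * thetaThree (-q ^ 2)) := by
    rw [h3, h4, h5, ← tsum_mul_left]
  have := mul_left_cancel₀ (two_ne_zero' ℝ) h6
  rw [this]
  exact (sq _).symm

/-! ### Limits at `q → 0` -/

/-- **`θ₃(q) → 1` as `q → 0`** (Tannery's theorem with the majorant `(1/2)^{|n|}` on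
`|q| ≤ 1/2`). [folklore] -/
theorem tendsto_thetaThree_nhds_zero : Tendsto thetaThree (𝓝 0) (𝓝 1) := by
  have hsum : Summable fun n : ℤ => (1 / 2 : ℝ) ^ n.natAbs := by
    have h := summable_abs_pow_natAbs (q := 1 / 2) (by rw [abs_of_pos (by norm_num)]; norm_num)
    simpa [abs_of_pos (show (0:ℝ) < 1 / 2 by norm_num)] using h
  have hlim : ∀ n : ℤ, Tendsto (fun q : ℝ => q ^ (n.natAbs ^ 2)) (𝓝 0)
      (𝓝 ((0 : ℝ) ^ (n.natAbs ^ 2))) := fun n => (continuous_pow _).tendsto 0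
  have hbound : ∀ᶠ q : ℝ in 𝓝 0, ∀ n : ℤ, ‖q ^ (n.natAbs ^ 2)‖ ≤ (1 / 2 : ℝ) ^ n.natAbs := by
    have hmem : Ioo (-(1 / 2 : ℝ)) (1 / 2) ∈ 𝓝 (0 : ℝ) := Ioo_mem_nhds (by norm_num) (by norm_num)
    filter_upwards [hmem] with q hq n
    have hq' : |q| ≤ 1 / 2 := abs_le.2 ⟨hq.1.le, hq.2.le⟩
    rw [norm_pow, Real.norm_eq_abs]
    calc |q| ^ (n.natAbs ^ 2) ≤ |q| ^ n.natAbs :=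
          pow_le_pow_of_le_one (abs_nonneg _) (by linarith) (Nat.le_self_pow two_ne_zero _)
      _ ≤ (1 / 2) ^ n.natAbs := pow_le_pow_left₀ (abs_nonneg _) hq' _
  have h := tendsto_tsum_of_dominated_convergence hsum hlim hbound
  have h0 : ∑' n : ℤ, (0 : ℝ) ^ (n.natAbs ^ 2) = 1 := by
    have e : (fun n : ℤ => (0 : ℝ) ^ (n.natAbs ^ 2)) = fun n => if n = 0 then (1 : ℝ) else 0 := by
      funext n
      split_ifs with hn
      · simp [hn]
      · exact zero_pow (pow_ne_zero 2 (Int.natAbs_ne_zero.2 hn))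
    rw [e]
    exact tsum_ite_eq 0 (fun _ => (1 : ℝ))
  rw [h0] at h
  exact h

/-- `θ₄(q) → 1` as `q → 0`. [folklore] -/
theorem tendsto_thetaFour_nhds_zero : Tendsto thetaFour (𝓝 0) (𝓝 1) := by
  have h : Tendsto (fun q : ℝ => -q) (𝓝 0) (𝓝 0) := by
    simpa using (continuous_neg (G := ℝ)).tendsto 0
  exact tendsto_thetaThree_nhds_zero.comp h

/-- `q^{2ⁿ} → 0` for `0 ≤ q < 1`. [folklore] -/
theorem tendsto_pow_two_pow {q : ℝ} (hq0 : 0 ≤ q) (hq1 : q < 1) :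
    Tendsto (fun n : ℕ => q ^ (2 ^ n)) atTop (𝓝 0) :=
  (tendsto_pow_atTop_nhds_zero_of_lt_one hq0 hq1).comp
    (tendsto_pow_atTop_atTop_of_one_lt one_lt_two)

/-! ### Positivity of `θ₄` on `[0,1)` -/

/-- `0 ≤ θ₄(q)` for `0 ≤ q < 1` (`θ₃θ₄ = θ₄(q²)² ≥ 0` and `θ₃ > 0`). [folklore] -/
theorem thetaFour_nonneg {q : ℝ} (hq0 : 0 ≤ q) (hq1 : q < 1) : 0 ≤ thetaFour q := by
  have hq : |q| < 1 := by rwa [abs_of_nonneg hq0]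
  have h := thetaThree_mul_thetaFour hq
  have h3 := thetaThree_pos hq0 hq1
  nlinarith [sq_nonneg (thetaFour (q ^ 2))]

/-- **`θ₄(q) ≠ 0` for `0 ≤ q < 1`**: a zero at `q₀` would propagate to `q₀², q₀⁴, …`
(`θ₄(q²)² = θ₃(q)θ₄(q)`), contradicting `θ₄(q₀^{2ⁿ}) → θ₄(0) = 1`. [folklore] -/
theorem thetaFour_ne_zero {q : ℝ} (hq0 : 0 ≤ q) (hq1 : q < 1) : thetaFour q ≠ 0 := by
  intro h0
  have hzero : ∀ n : ℕ, thetaFour (q ^ (2 ^ n)) = 0 := by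
    intro n
    induction n with
    | zero => simpa using h0
    | succ n ih =>
      have hqn : |q ^ (2 ^ n)| < 1 := by
        rw [abs_of_nonneg (pow_nonneg hq0 _)]
        exact pow_lt_one₀ hq0 hq1 (pow_ne_zero n two_ne_zero)
      have h := thetaThree_mul_thetaFour hqn
      rw [ih, mul_zero, ← pow_mul, ← pow_succ] at h
      exact pow_eq_zero_iff two_ne_zero |>.1 h.symm
  have hlim : Tendsto (fun n : ℕ => thetaFour (q ^ (2 ^ n))) atTop (𝓝 1) :=
    tendsto_thetaFour_nhds_zero.comp (tendsto_pow_two_pow hq0 hq1)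
  have hconst : Tendsto (fun n : ℕ => thetaFour (q ^ (2 ^ n))) atTop (𝓝 0) := by
    simp only [hzero]; exact tendsto_const_nhds
  exact one_ne_zero (tendsto_nhds_unique hlim hconst)

/-- `0 < θ₄(q)` for `0 ≤ q < 1`. [folklore] -/
theorem thetaFour_pos {q : ℝ} (hq0 : 0 ≤ q) (hq1 : q < 1) : 0 < thetaFour q :=
  lt_of_le_of_ne (thetaFour_nonneg hq0 hq1) (thetaFour_ne_zero hq0 hq1).symm

/-! ### The AGM of `(θ₄², θ₃²)` is `1` -/

/-- `θ₃(q)²` as a nonnegative real (the AGM lives on `ℝ≥0`). [folklore] -/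
def thetaThreeSq (q : ℝ) : ℝ≥0 := ⟨thetaThree q ^ 2, sq_nonneg _⟩

/-- `θ₄(q)²` as a nonnegative real. [folklore] -/
def thetaFourSq (q : ℝ) : ℝ≥0 := ⟨thetaFour q ^ 2, sq_nonneg _⟩

/-- Coercion: `(thetaThreeSq q : ℝ) = θ₃(q)²`. [folklore] -/
@[simp] theorem coe_thetaThreeSq (q : ℝ) : (thetaThreeSq q : ℝ) = thetaThree q ^ 2 := rfl

/-- Coercion: `(thetaFourSq q : ℝ) = θ₄(q)²`. [folklore] -/
@[simp] theorem coe_thetaFourSq (q : ℝ) : (thetaFourSq q : ℝ) = thetaFour q ^ 2 := rfl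

/-- One AGM step on `(θ₄(q)², θ₃(q)²)` lands on `(θ₄(q²)², θ₃(q²)²)`: geometric mean
`θ₃θ₄ = θ₄(q²)²`, arithmetic mean `(θ₃² + θ₄²)/2 = θ₃(q²)²` (`0 ≤ q < 1`).
[cite: BorweinBorwein1987, §2.1 Thm 2.1] -/
theorem agm_step_theta {q : ℝ} (hq0 : 0 ≤ q) (hq1 : q < 1) :
    NNReal.sqrt (thetaFourSq q * thetaThreeSq q) = thetaFourSq (q ^ 2) ∧
      (thetaFourSq q + thetaThreeSq q) / 2 = thetaThreeSq (q ^ 2) := by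
  have hq : |q| < 1 := by rwa [abs_of_nonneg hq0]
  have h34 := thetaThree_mul_thetaFour hq
  have hsum := thetaThree_sq_add_thetaFour_sq hq
  have h4 := thetaFour_nonneg hq0 hq1
  have h3 := (thetaThree_pos hq0 hq1).le
  constructor
  · apply NNReal.eq
    rw [Real.coe_sqrt, NNReal.coe_mul, coe_thetaFourSq, coe_thetaThreeSq, coe_thetaFourSq,
      show thetaFour q ^ 2 * thetaThree q ^ 2 = (thetaThree q * thetaFour q) ^ 2 by ring,
      Real.sqrt_sq (mul_nonneg h3 h4), h34]
  · apply NNReal.eq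
    rw [NNReal.coe_div, NNReal.coe_add, coe_thetaFourSq, coe_thetaThreeSq, coe_thetaThreeSq,
      NNReal.coe_ofNat]
    linarith

/-- The AGM of `(θ₄², θ₃²)` is invariant under `q ↦ q²` (`0 ≤ q < 1`). [folklore] -/
theorem agm_thetaSq_eq_agm_thetaSq_sq {q : ℝ} (hq0 : 0 ≤ q) (hq1 : q < 1) :
    NNReal.agm (thetaFourSq q) (thetaThreeSq q) =
      NNReal.agm (thetaFourSq (q ^ 2)) (thetaThreeSq (q ^ 2)) := by
  obtain ⟨h1, h2⟩ := agm_step_theta hq0 hq1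
  rw [NNReal.agm_eq_agm_gm_am, h1, h2]

/-- **`M(θ₄(q)², θ₃(q)²) = 1`** for `0 ≤ q < 1` (Borwein–Borwein Thm 2.1, AGM part): the AGM is
invariant along `q ↦ q²`, and `θ₃(q^{2ⁿ}), θ₄(q^{2ⁿ}) → 1`. [cite: BorweinBorwein1987, §2.1 Thm 2.1] -/
theorem agm_thetaFourSq_thetaThreeSq {q : ℝ} (hq0 : 0 ≤ q) (hq1 : q < 1) :
    NNReal.agm (thetaFourSq q) (thetaThreeSq q) = 1 := by
  have hqn0 : ∀ n : ℕ, 0 ≤ q ^ (2 ^ n) := fun n => pow_nonneg hq0 _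
  have hqn1 : ∀ n : ℕ, q ^ (2 ^ n) < 1 := fun n => pow_lt_one₀ hq0 hq1 (pow_ne_zero n two_ne_zero)
  -- invariance along the orbit `q ↦ q²`
  have hconst : ∀ n : ℕ, NNReal.agm (thetaFourSq (q ^ (2 ^ n))) (thetaThreeSq (q ^ (2 ^ n))) =
      NNReal.agm (thetaFourSq q) (thetaThreeSq q) := by
    intro n
    induction n with
    | zero => simp
    | succ n ih =>
      rw [← ih, agm_thetaSq_eq_agm_thetaSq_sq (hqn0 n) (hqn1 n), ← pow_mul, ← pow_succ]
  -- limits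
  have hq2 := tendsto_pow_two_pow hq0 hq1
  have ha1 : Tendsto (fun n : ℕ => thetaThreeSq (q ^ (2 ^ n))) atTop (𝓝 1) := by
    rw [← NNReal.tendsto_coe]
    have h := ((continuous_pow 2).tendsto 1).comp (tendsto_thetaThree_nhds_zero.comp hq2)
    simpa [Function.comp_def] using h
  have hb1 : Tendsto (fun n : ℕ => thetaFourSq (q ^ (2 ^ n))) atTop (𝓝 1) := by
    rw [← NNReal.tendsto_coe]
    have h := ((continuous_pow 2).tendsto 1).comp (tendsto_thetaFour_nhds_zero.comp hq2)
    simpa [Function.comp_def] using h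
  have hmin : Tendsto (fun n : ℕ => min (thetaFourSq (q ^ (2 ^ n))) (thetaThreeSq (q ^ (2 ^ n))))
      atTop (𝓝 1) := by
    simpa using hb1.min ha1
  have hmax : Tendsto (fun n : ℕ => max (thetaFourSq (q ^ (2 ^ n))) (thetaThreeSq (q ^ (2 ^ n))))
      atTop (𝓝 1) := by
    simpa using hb1.max ha1
  have hagm : Tendsto (fun n : ℕ => NNReal.agm (thetaFourSq (q ^ (2 ^ n))) (thetaThreeSq (q ^ (2 ^ n))))
      atTop (𝓝 1) :=
    tendsto_of_tendsto_of_tendsto_of_le_of_le hmin hmax (fun n => NNReal.min_le_agm)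
      (fun n => NNReal.agm_le_max)
  have hc : Tendsto (fun n : ℕ => NNReal.agm (thetaFourSq (q ^ (2 ^ n))) (thetaThreeSq (q ^ (2 ^ n))))
      atTop (𝓝 (NNReal.agm (thetaFourSq q) (thetaThreeSq q))) := by
    simp only [hconst]
    exact tendsto_const_nhds
  exact tendsto_nhds_unique hc hagm

end Literature.Analysis.SpecialFunctions

end
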